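import Summits.FinalStateConjecture.FinalStateConjecture.Theorems.ClusterCompletenessAdiabaticMultiKerrILEDMorawetzWeightedGraph
import Summits.FinalStateConjecture.FinalStateConjecture.Theorems.ClusterCompletenessAdiabaticMultiKerrILEDTailsCutStationary
import Summits.FinalStateConjecture.FinalStateConjecture.Theorems.ClusterCompletenessAdiabaticMultiKerrILEDHardyCurrent
import Summits.FinalStateConjecture.FinalStateConjecture.Theorems.ClusterCompletenessAdiabaticMultiKerrILEDRestFrameDegenerateILEDAux
import Literature.Geometry.Lorentzian.KerrSchildDerivativeDecay

/-!
# Route ClusterCompleteness — crux `AdiabaticMultiKerrILED`, line `Sketch`: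
# the weighted slab inequality of the degenerate Morawetz estimate (rest frame)

Helper file for the crux `stmt-FinalStateConjecture-14310`
(`Summit.FinalStateConjecture.FinalStateConjecture.Theses.ClusterCompleteness.AdiabaticMultiKerrILED`),
line `Sketch`, stub `restFrame_degenerateILED_zeroSpin` (lead c7, wave 6), second auxiliary file.
Setting: `M > 0`, `r = Kerr.radius 0 = ‖x⃗‖`, `χ = Real.smoothTransition`, tails-cut profile
`μ = χ(2 − r/(8M)) · 2H`, `f = 1 − μ`, `u₂ = Kerr.horizonFn M 0`, weights `W_h = χ(u₂/ε − 1)`,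
`W_R = χ(2 − ‖x⃗‖²/R²)`, `Wt_ε = W_h W_R`, tilted leaves `(u + F(y), y)` (`F ∈ C²`, `‖∇F‖ ≤ ½`).

* `degILED_horizon_pointwise` — **registered stub**: the horizon-layer term `∑ ∂W_h · j` is bounded
  below by the explicit continuous density `−K χ′(u₂/ε − 1)(u₂/ε) Q/M` at slab points `x⁰ ≤ T` with
  `16 ε e^{T/2M} ≤ M` (from the `O(f)` lower bound on `{r ≤ 3M}`: `dW_h = χ′ ε⁻¹ du₂`,
  `‖du₂‖ ≤ e^{−x⁰/2M}(1 + (r−2M)/2M)`, `f = (r−2M)/r`, so `f‖dW_h‖ ≤ χ′u₂/(εM)`; for `r > 3M` one has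
  `u₂ > 16ε`, where `χ′(u₂/ε − 1) = 0`);
* `degILED_weighted_le` — for an abstract current `J` (regular off the axis, `Wt J ∈ C¹`, `𝔅 ≤ ∑∂J` at
  slab points with `r > 2M`, horizon-layer lower bound, leaf flux and static-layer bounds `K_fΛ`,
  `(K_R/R)Λ`): `∫_{(0,s]} ∫ Wt_ε 𝔅 ≤ 2K_fΛ + s(K_R/R)Λ` whenever `16 ε e^{(s+|F(0)|+2R)/2M} ≤ M` — the
  energy identity `weightedGraphFlux_integral_le_of_bulk` for the weights `Wt_{ε_n}`, `ε_n = ε/(n+1)`,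
  with density `ℓ = Wt_ε 𝔅` and error `e_h + e_R`, and `n → ∞` (`degILED_horizonError_tendsto`).

Dafermos–Rodnianski arXiv:0811.0354, §4.1 (the degenerate `X`-estimate); Dafermos–Rodnianski–
Shlapentokh-Rothman arXiv:1402.7034, §2.3.2. [folklore]
-/

noncomputable section

-- the doubled `FinalStateConjecture.FinalStateConjecture` path component trips dupNamespace
set_option linter.dupNamespace false

open Set Filter Metric MeasureTheory
open scoped BigOperators Topology ENNReal
open Literature.Geometry.Lorentzian

namespace Summit.FinalStateConjecture.FinalStateConjecture.Theorems

/-! ### The horizon layer: a continuous dominating density -/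

/-- **The horizon-layer term is bounded below by an explicit continuous density.** At a point
with `r > 2M` and `x⁰ ≤ T`, for `ε > 0` with `16 ε e^{T/2M} ≤ M`, `K, Q ≥ 0`: if on `{r ≤ 3M}` the
pairing `∑_μ ∂_μW_h j^μ` (`W_h = χ(u₂/ε − 1)`) is `≥ −f K ‖dW_h‖ Q` (`f = 1 − μ`), then
`∑_μ ∂_μW_h j^μ ≥ −K χ′(u₂/ε − 1) (u₂/ε) Q / M`. Indeed `dW_h = χ′(u₂/ε − 1) ε⁻¹ du₂` with
`‖du₂‖ ≤ e^{−x⁰/2M}(1 + (r − 2M)/2M)` (`‖∇r‖ ≤ 1`, `Kerr.fderiv_horizonFn_apply`) and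
`f = (r − 2M)/r` (`r ≤ 8M`), so `f ‖du₂‖ ≤ u₂/M`; while for `r > 3M` one has
`u₂ > M e^{−T/2M} ≥ 16ε`, where `χ′(u₂/ε − 1) = 0`. [folklore] -/
theorem degILED_horizon_pointwise : ∀ (M ε T K Q : ℝ) (x : E4) (j : Fin 4 → ℝ), 0 < M → 0 < ε → 0 ≤ K → 0 ≤ Q → 16 * ε * Real.exp (T / (2 * M)) ≤ M → 2 * M < Kerr.radius 0 x → x 0 ≤ T → (Kerr.radius 0 x ≤ 3 * M → -((1 - Real.smoothTransition (2 - Kerr.radius 0 x / (8 * M)) * (2 * Kerr.scalarH M 0 x)) * K * ‖fderiv ℝ (fun y ↦ Real.smoothTransition (Kerr.horizonFn M 0 y / ε - 1)) x‖ * Q) ≤ ∑ μ, fderiv ℝ (fun y ↦ Real.smoothTransition (Kerr.horizonFn M 0 y / ε - 1)) x (E4.basisVector μ) * j μ) → -(K * (deriv Real.smoothTransition (Kerr.horizonFn M 0 x / ε - 1) * (Kerr.horizonFn M 0 x / ε)) / M * Q) ≤ ∑ μ, fderiv ℝ (fun y ↦ Real.smoothTransition (Kerr.horizonFn M 0 y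 / ε - 1)) x (E4.basisVector μ) * j μ := by
  intro M ε T K Q x j hM hε hK hQ hεT hx hxT hhor
  have hxpos : 0 < Kerr.radius 0 x := by linarith
  have hrp : Kerr.rPlus M 0 = 2 * M := Kerr.rPlus_zero_right hM.le
  have hu : Kerr.horizonFn M 0 x = (Kerr.radius 0 x - 2 * M) * Real.exp (-((2 * M)⁻¹ * x 0)) := by
    rw [Kerr.horizonFn, hrp]
  have hσ0 := Literature.NumberTheory.Sieve.GreenTao2008.deriv_smoothTransition_nonneg
    (Kerr.horizonFn M 0 x / ε - 1)
  -- the chain rule for the horizon factor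
  have haff : HasDerivAt (fun u : ℝ ↦ u / ε - 1) (1 / ε) (Kerr.horizonFn M 0 x) :=
    ((hasDerivAt_id _).div_const ε).sub_const 1
  have hd : HasFDerivAt (fun y ↦ Real.smoothTransition (Kerr.horizonFn M 0 y / ε - 1))
      ((deriv Real.smoothTransition (Kerr.horizonFn M 0 x / ε - 1) * (1 / ε)) •
        fderiv ℝ (Kerr.horizonFn M 0) x) x :=
    (((Real.smoothTransition.contDiffAt (n := 1)).differentiableAt (by simp)).hasDerivAt.comp _
      haff).comp_hasFDerivAt x
      (((Kerr.contDiffAt_horizonFn M hxpos (n := 1)).differentiableAt (by simp)).hasFDerivAt)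
  rcases le_or_gt (Kerr.radius 0 x) (3 * M) with h3 | h3
  · refine le_trans (neg_le_neg ?_) (hhor h3)
    have hk : 0 ≤ (2 * M)⁻¹ * (Kerr.radius 0 x - 2 * M) := mul_nonneg (by positivity) (by linarith)
    -- the norm of the differential of `u₂`
    have hn : ‖fderiv ℝ (Kerr.horizonFn M 0) x‖ ≤
        Real.exp (-((2 * M)⁻¹ * x 0)) * (1 + (2 * M)⁻¹ * (Kerr.radius 0 x - 2 * M)) := by
      refine ContinuousLinearMap.opNorm_le_bound _ (by positivity) fun v ↦ ?_
      rw [Kerr.fderiv_horizonFn_apply hxpos, hrp, Real.norm_eq_abs, abs_mul,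
        abs_of_pos (Real.exp_pos _), mul_assoc (Real.exp (-((2 * M)⁻¹ * x 0)))]
      refine mul_le_mul_of_nonneg_left ?_ (Real.exp_pos _).le
      have hg : ‖Kerr.radiusGrad 0 (E4.spatial x)‖ ≤ 1 := by
        have hr' : Kerr.radius 0 (E4.ofTimeSpace 0 (E4.spatial x)) = Kerr.radius 0 x := by
          rw [Kerr.radius_zero_left, Kerr.radius_zero_left, E4.spatialNorm_ofTimeSpace]
          rfl
        simpa using Kerr.norm_radiusGrad_le_radius (a := 0) (y := E4.spatial x) (hr' ▸ hxpos)
      have h1 : |Kerr.radiusGrad 0 (E4.spatial x) (E4.spatial v)| ≤ ‖v‖ := by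
        rw [← Real.norm_eq_abs]
        refine ((Kerr.radiusGrad 0 (E4.spatial x)).le_opNorm _).trans ?_
        calc _ ≤ 1 * ‖E4.spatial v‖ := mul_le_mul_of_nonneg_right hg (norm_nonneg _)
          _ ≤ ‖v‖ := by rw [one_mul]; exact E4.spatialNorm_le_norm v
      have h2 : |(2 * M)⁻¹ * (Kerr.radius 0 x - 2 * M) * v 0| ≤
          (2 * M)⁻¹ * (Kerr.radius 0 x - 2 * M) * ‖v‖ := by
        rw [abs_mul, abs_of_nonneg hk]
        exact mul_le_mul_of_nonneg_left (by simpa using PiLp.norm_apply_le v 0) hk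
      calc _ ≤ _ := abs_sub _ _
        _ ≤ ‖v‖ + (2 * M)⁻¹ * (Kerr.radius 0 x - 2 * M) * ‖v‖ := add_le_add h1 h2
        _ = (1 + (2 * M)⁻¹ * (Kerr.radius 0 x - 2 * M)) * ‖v‖ := by ring
    -- `f = 1 − μ = (r − 2M)/r` inside `{r ≤ 8M}`, and `f ‖du₂‖ ≤ u₂/M`
    have hf : 1 - Real.smoothTransition (2 - Kerr.radius 0 x / (8 * M)) * (2 * Kerr.scalarH M 0 x) =
        (Kerr.radius 0 x - 2 * M) / Kerr.radius 0 x := by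
      rw [tailsCut_profile_eq_of_radius_le M 0 x hM (by linarith), hardy_scalarH_zero]
      field_simp
    have key : (Kerr.radius 0 x - 2 * M) / Kerr.radius 0 x * ‖fderiv ℝ (Kerr.horizonFn M 0) x‖ ≤
        Kerr.horizonFn M 0 x / M := by
      rw [hu]
      calc _ ≤ (Kerr.radius 0 x - 2 * M) / Kerr.radius 0 x *
            (Real.exp (-((2 * M)⁻¹ * x 0)) * (1 + (2 * M)⁻¹ * (Kerr.radius 0 x - 2 * M))) :=
            mul_le_mul_of_nonneg_left hn (div_nonneg (by linarith) hxpos.le)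
        _ = (Kerr.radius 0 x - 2 * M) * Real.exp (-((2 * M)⁻¹ * x 0)) / (2 * M) := by
            field_simp
            ring
        _ ≤ (Kerr.radius 0 x - 2 * M) * Real.exp (-((2 * M)⁻¹ * x 0)) / M :=
            div_le_div_of_nonneg_left (mul_nonneg (by linarith) (Real.exp_pos _).le) hM
              (by linarith)
    rw [hd.fderiv, norm_smul, Real.norm_eq_abs, abs_of_nonneg (mul_nonneg hσ0 (by positivity)), hf]
    calc (Kerr.radius 0 x - 2 * M) / Kerr.radius 0 x * K *
          (deriv Real.smoothTransition (Kerr.horizonFn M 0 x / ε - 1) * (1 / ε) *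
            ‖fderiv ℝ (Kerr.horizonFn M 0) x‖) * Q
        = K * deriv Real.smoothTransition (Kerr.horizonFn M 0 x / ε - 1) * (1 / ε) * Q *
            ((Kerr.radius 0 x - 2 * M) / Kerr.radius 0 x * ‖fderiv ℝ (Kerr.horizonFn M 0) x‖) := by
          ring
      _ ≤ K * deriv Real.smoothTransition (Kerr.horizonFn M 0 x / ε - 1) * (1 / ε) * Q *
            (Kerr.horizonFn M 0 x / M) :=
          mul_le_mul_of_nonneg_left key (mul_nonneg (mul_nonneg (mul_nonneg hK hσ0) (by positivity)) hQ)
      _ = _ := by ring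
  · -- beyond `3M` the layer is not reached: `χ′ = 0`
    have hu16 : 16 * ε < Kerr.horizonFn M 0 x := by
      rw [hu]
      have h1 : Real.exp (-(T / (2 * M))) ≤ Real.exp (-((2 * M)⁻¹ * x 0)) := by
        rw [Real.exp_le_exp, inv_mul_eq_div, neg_le_neg_iff]
        exact div_le_div_of_nonneg_right hxT (by positivity)
      have h2 : 16 * ε ≤ M * Real.exp (-(T / (2 * M))) := by
        rwa [Real.exp_neg, ← div_eq_mul_inv, le_div_iff₀ (Real.exp_pos _)]
      have h4 : M * Real.exp (-((2 * M)⁻¹ * x 0)) <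
          (Kerr.radius 0 x - 2 * M) * Real.exp (-((2 * M)⁻¹ * x 0)) :=
        mul_lt_mul_of_pos_right (by linarith) (Real.exp_pos _)
      nlinarith [mul_le_mul_of_nonneg_left h1 hM.le]
    have ht : 1 < Kerr.horizonFn M 0 x / ε - 1 := by rw [lt_sub_iff_add_lt, lt_div_iff₀ hε]; linarith
    rw [hd.fderiv,
      Literature.Topology.FourManifolds.deriv_smoothTransition_eq_zero (Or.inr ht)]
    simp

/-! ### The weighted inequality on a slab -/

/-- **The weighted slab inequality for the good bulk**, abstract in the current `J` and the bulk
`𝔅`: given the regularity of `J` and of `Wt J`, `𝔅 ≤ ∑∂J` at the slab points with `r > 2M`, the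
horizon-layer lower bound, and uniform bounds `K_f Λ` (weighted leaf fluxes), `(K_R/R) Λ` (static
layer), `∫_{(0,s]} ∫ Wt_ε 𝔅 ≤ 2K_fΛ + s (K_R/R) Λ` when `16 ε e^{(s+|F(0)|+2R)/2M} ≤ M`: for every
`n`, `weightedGraphFlux_integral_le_of_bulk` with the weight `Wt_{ε_n}` (`ε_n = ε/(n+1) ≤ ε`), the
density `ℓ = Wt_ε 𝔅` and the error `e_h + e_R` (`degILED_div_pointwise`, `degILED_horizon_pointwise`;
`x⁰ ≤ s + |F(0)| + 2R` on the slab where `W_R ≠ 0`), then `n → ∞` (`degILED_horizonError_tendsto`).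
DR arXiv:0811.0354, §4.1; DRSR arXiv:1402.7034, §2.3.2. [folklore] -/
theorem degILED_weighted_le {M ε R s Kf Kh KR Λr : ℝ} {F : E3 → ℝ} {Φ : E4 → ℝ}
    {J : E4 → Fin 4 → ℝ} {B : E4 → ℝ} (hM : 0 < M) (hε : 0 < ε) (hR : 16 * M ≤ R) (hs : 0 ≤ s)
    (hKh : 0 ≤ Kh) (hεT : 16 * ε * Real.exp ((s + |F 0| + 2 * R) / (2 * M)) ≤ M)
    (hF : ContDiff ℝ 2 F) (hslope : ∀ y, ‖fderiv ℝ F y‖ ≤ 2⁻¹) (hΦ : ContDiff ℝ 2 Φ)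
    (hJ : ∀ x, 0 < Kerr.radius 0 x → ∀ μ, ContDiffAt ℝ 1 (fun y ↦ J y μ) x)
    (hWJ : ∀ ε', 0 < ε' → ∀ μ : Fin 4, ContDiff ℝ 1 (fun y ↦
      (Real.smoothTransition (Kerr.horizonFn M 0 y / ε' - 1) *
        Real.smoothTransition (2 - E4.spatialNorm y ^ 2 / R ^ 2)) * J y μ))
    (hBc : ∀ x, 2 * M < Kerr.radius 0 x → ContinuousAt B x)
    (hB0 : ∀ x, 2 * M < Kerr.radius 0 x → 0 ≤ B x)
    (hBJ : ∀ x : E4, F (E4.spatial x) ≤ x 0 → 2 * M < Kerr.radius 0 x →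
      B x ≤ ∑ μ, fderiv ℝ (fun y ↦ J y μ) x (E4.basisVector μ))
    (hhor : ∀ (ε' : ℝ) (x : E4), 0 < ε' → 2 * M < Kerr.radius 0 x → Kerr.radius 0 x ≤ 3 * M →
      -((1 - (Real.smoothTransition (2 - Kerr.radius 0 x / (8 * M)) * (2 * Kerr.scalarH M 0 x))) * Kh *
          ‖fderiv ℝ (fun y ↦ Real.smoothTransition (Kerr.horizonFn M 0 y / ε' - 1)) x‖ *
          (∑ μ, fderiv ℝ Φ x (E4.basisVector μ) ^ 2 + Φ x ^ 2 / M ^ 2)) ≤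
        ∑ μ, fderiv ℝ (fun y ↦ Real.smoothTransition (Kerr.horizonFn M 0 y / ε' - 1)) x
          (E4.basisVector μ) * J x μ)
    (hflux : ∀ (ε' t : ℝ), 0 < ε' → 0 ≤ t →
      |∫ y : E3, (Real.smoothTransition (Kerr.horizonFn M 0 (E4.ofTimeSpace (t + F y) y) / ε' - 1) *
          Real.smoothTransition (2 - E4.spatialNorm (E4.ofTimeSpace (t + F y) y) ^ 2 / R ^ 2)) *
        (-∑ μ, J (E4.ofTimeSpace (t + F y) y) μ * Kerr.graphConormal F y μ)| ≤ Kf * Λr)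
    (hstat : ∀ (ε' u : ℝ), 0 < ε' → 0 ≤ u →
      ∫ y : E3, Real.smoothTransition (Kerr.horizonFn M 0 (E4.ofTimeSpace (u + F y) y) / ε' - 1) *
        |∑ μ, fderiv ℝ (fun z : E4 ↦ Real.smoothTransition (2 - E4.spatialNorm z ^ 2 / R ^ 2))
          (E4.ofTimeSpace (u + F y) y) (E4.basisVector μ) * J (E4.ofTimeSpace (u + F y) y) μ| ≤
        KR / R * Λr) :
    ∫ u in Ioc 0 s, ∫ y : E3,
      (Real.smoothTransition (Kerr.horizonFn M 0 (E4.ofTimeSpace (u + F y) y) / ε - 1) *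
          Real.smoothTransition (2 - E4.spatialNorm (E4.ofTimeSpace (u + F y) y) ^ 2 / R ^ 2)) *
        B (E4.ofTimeSpace (u + F y) y) ≤ 2 * (Kf * Λr) + s * (KR / R * Λr) := by
  have hRpos : 0 < R := lt_of_lt_of_le (by positivity) hR
  have hrp : 0 < Kerr.rPlus M 0 := by rw [Kerr.rPlus_zero_right hM.le]; positivity
  -- the slope of `F`
  have hFub : ∀ y : E3, F y ≤ |F 0| + 2⁻¹ * ‖y‖ := fun y ↦ by
    have h := convex_univ.norm_image_sub_le_of_norm_fderiv_le
      (fun z _ ↦ hF.differentiable (by simp) z) (fun z _ ↦ hslope z) (mem_univ 0) (mem_univ y)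
    rw [Real.norm_eq_abs, sub_zero] at h
    linarith [(abs_le.mp h).2, le_abs_self (F 0)]
  have hDmc : Continuous fun x : E4 ↦ ∑ μ, fderiv ℝ Φ x (E4.basisVector μ) ^ 2 + Φ x ^ 2 / M ^ 2 :=
    (continuous_finsetSum _ fun μ _ ↦
      ((hΦ.continuous_fderiv two_ne_zero).clm_apply continuous_const).pow 2).add
      ((hΦ.continuous.pow 2).div_const _)
  have hDm0 : ∀ x : E4, 0 ≤ ∑ μ, fderiv ℝ Φ x (E4.basisVector μ) ^ 2 + Φ x ^ 2 / M ^ 2 := fun x ↦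
    add_nonneg (Finset.sum_nonneg fun _ _ ↦ sq_nonneg _) (by positivity)
  -- the error densities: the horizon layer `eh` and the static layer `eR`
  obtain ⟨eh, heh⟩ : ∃ eh : ℕ → E4 → ℝ, eh = fun (n : ℕ) (x : E4) ↦
      Real.smoothTransition (2 - E4.spatialNorm x ^ 2 / R ^ 2) *
        (Kh * (deriv Real.smoothTransition (Kerr.horizonFn M 0 x / (ε / (n + 1)) - 1) *
          (Kerr.horizonFn M 0 x / (ε / (n + 1)))) / M *
          (∑ μ, fderiv ℝ Φ x (E4.basisVector μ) ^ 2 + Φ x ^ 2 / M ^ 2)) := ⟨_, rfl⟩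
  obtain ⟨eR, heR⟩ : ∃ eR : ℕ → E4 → ℝ, eR = fun (n : ℕ) (x : E4) ↦
      Real.smoothTransition (Kerr.horizonFn M 0 x / (ε / (n + 1)) - 1) *
        |∑ μ, fderiv ℝ (fun z : E4 ↦ Real.smoothTransition (2 - E4.spatialNorm z ^ 2 / R ^ 2)) x
          (E4.basisVector μ) * J x μ| := ⟨_, rfl⟩
  obtain ⟨hT, hHI, hehc⟩ :=
    degILED_horizonError_tendsto (s := s) hM hε hRpos hKh hF.continuous hDmc heh
  have hεn : ∀ n : ℕ, 0 < ε / ((n : ℝ) + 1) ∧ ε / ((n : ℝ) + 1) ≤ ε := fun n ↦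
    ⟨by positivity, div_le_self hε.le (by linarith [n.cast_nonneg (α := ℝ)])⟩
  -- regularity of the static cut-off and of `∑ ∂W_R J`
  have hWRd : ContDiff ℝ 1 fun z : E4 ↦ Real.smoothTransition (2 - E4.spatialNorm z ^ 2 / R ^ 2) :=
    (Real.smoothTransition.contDiff (n := 1)).comp
      (contDiff_const.sub (Kerr.contDiff_spatialNorm_sq.div_const _))
  have hsumc : Continuous fun x : E4 ↦ ∑ μ, fderiv ℝ
      (fun z : E4 ↦ Real.smoothTransition (2 - E4.spatialNorm z ^ 2 / R ^ 2)) x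
        (E4.basisVector μ) * J x μ := by
    refine continuous_finsetSum _ fun μ _ ↦ continuous_iff_continuousAt.2 fun x ↦ ?_
    refine continuousAt_weight_mul (K := {x : E4 | R ^ 2 ≤ E4.spatialNorm x ^ 2})
      (U := {x : E4 | 0 < Kerr.radius 0 x})
      (isClosed_le continuous_const (Kerr.contDiff_spatialNorm_sq (n := 0)).continuous)
      (fun x hx ↦ ?_) ((hWRd.continuous_fderiv one_ne_zero).clm_apply continuous_const)
      (fun x hx ↦ ?_) (fun x hx ↦ (hJ x hx μ).continuousAt) x
    · have hx' : R ^ 2 ≤ E4.spatialNorm x ^ 2 := hx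
      rw [mem_setOf_eq, Kerr.radius_zero_left]
      nlinarith [E4.spatialNorm_nonneg x, hRpos]
    · rw [degILED_fderiv_staticCutoff_eq_zero hRpos (Or.inl (not_le.mp hx))]
      rfl
  have heRc : ∀ n : ℕ, Continuous (eR n) := fun n ↦ by
    rw [heR]
    exact (Kerr.contDiff_horizonFactor (n := 0) hrp (hεn n).1).continuous.mul hsumc.abs
  -- sign and support of the error densities
  have heh0 : ∀ n x, 0 ≤ eh n x := fun n x ↦ by
    rw [heh]
    have h := (degILED_deriv_mul_bounds (Kerr.horizonFn M 0 x / (ε / (n + 1)) - 1)).1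
    rw [sub_add_cancel] at h
    exact mul_nonneg (Real.smoothTransition.nonneg _)
      (mul_nonneg (div_nonneg (mul_nonneg hKh h) hM.le) (hDm0 x))
  have heR0 : ∀ n x, 0 ≤ eR n x := fun n x ↦ by
    simpa only [heR] using mul_nonneg (Real.smoothTransition.nonneg _) (abs_nonneg _)
  have hez : ∀ (n : ℕ) (x : E4),
      (Kerr.horizonFn M 0 x < ε / (n + 1) ∨ 2 * R ^ 2 < E4.spatialNorm x ^ 2) →
      eh n x = 0 ∧ eR n x = 0 := by
    intro n x hx
    rw [heh, heR]
    rcases hx with h | h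
    · have h1 : Kerr.horizonFn M 0 x / (ε / (n + 1)) - 1 < 0 := by
        rwa [sub_neg, div_lt_one (hεn n).1]
      simp [Literature.Topology.FourManifolds.deriv_smoothTransition_eq_zero (Or.inl h1),
        Real.smoothTransition.zero_of_nonpos h1.le]
    · have h1 : Real.smoothTransition (2 - E4.spatialNorm x ^ 2 / R ^ 2) = 0 :=
        Real.smoothTransition.zero_of_nonpos (by
          rw [sub_nonpos, le_div_iff₀ (by positivity)]
          linarith)
      simp [h1, degILED_fderiv_staticCutoff_eq_zero hRpos (Or.inr h)]
  -- ### Step 1: the inequality with the weight `Wt_{ε_n}` and the error `e_n = eh n + eR n`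
  have hstep : ∀ n : ℕ, ∫ u in Ioc 0 s, ∫ y : E3,
      (Real.smoothTransition (Kerr.horizonFn M 0 (E4.ofTimeSpace (u + F y) y) / ε - 1) *
          Real.smoothTransition (2 - E4.spatialNorm (E4.ofTimeSpace (u + F y) y) ^ 2 / R ^ 2)) *
        B (E4.ofTimeSpace (u + F y) y) ≤
      Kf * Λr + Kf * Λr +
        ((∫ u in Ioc 0 s, ∫ y : E3, eh n (E4.ofTimeSpace (u + F y) y)) + s * (KR / R * Λr)) := by
    intro n
    obtain ⟨hεn0, hεnε⟩ := hεn n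
    have hWhd : ContDiff ℝ 1 fun y : E4 ↦
        Real.smoothTransition (Kerr.horizonFn M 0 y / (ε / (n + 1)) - 1) :=
      Kerr.contDiff_horizonFactor hrp hεn0
    -- the support set of the weight
    set K : Set E4 := {x | ε / (n + 1) ≤ Kerr.horizonFn M 0 x ∧ E4.spatialNorm x ^ 2 ≤ 2 * R ^ 2}
      with hK
    have hKc : IsClosed K := by
      rw [hK, setOf_and]
      exact (isClosed_le continuous_const (Kerr.continuous_horizonFn M 0)).inter
        (isClosed_le (Kerr.contDiff_spatialNorm_sq (n := 0)).continuous continuous_const)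
    have hρ : ∀ x ∈ K, F (E4.spatial x) ≤ x 0 → x 0 ≤ s + F (E4.spatial x) →
        E4.spatialNorm x ≤ 2 * R ∧ 2 * M < Kerr.radius 0 x := fun x hx _ _ ↦
      ⟨by nlinarith [E4.spatialNorm_nonneg x, hx.2], by
        rw [← Kerr.rPlus_zero_right hM.le]
        exact Kerr.rPlus_lt_radius_of_horizonFn_pos (lt_of_lt_of_le hεn0 hx.1)⟩
    have hnotK : ∀ x, x ∉ K →
        Kerr.horizonFn M 0 x < ε / (n + 1) ∨ 2 * R ^ 2 < E4.spatialNorm x ^ 2 := fun x hx ↦ by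
      by_contra h
      exact hx (by rwa [not_or, not_lt, not_lt] at h)
    have hWK : ∀ x, x ∉ K → Real.smoothTransition (Kerr.horizonFn M 0 x / (ε / (n + 1)) - 1) *
        Real.smoothTransition (2 - E4.spatialNorm x ^ 2 / R ^ 2) = 0 := fun x hx ↦
      (hnotK x hx).elim (tailsCutWeight_eq_zero_of_horizonFn_lt hεn0)
        (tailsCutWeight_eq_zero_of_lt_spatialNorm_sq hRpos)
    have hℓK : ∀ x, x ∉ K → Real.smoothTransition (Kerr.horizonFn M 0 x / ε - 1) *
        Real.smoothTransition (2 - E4.spatialNorm x ^ 2 / R ^ 2) * B x = 0 := fun x hx ↦ by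
      rw [(hnotK x hx).elim (fun h ↦ tailsCutWeight_eq_zero_of_horizonFn_lt hε (h.trans_le hεnε))
        (tailsCutWeight_eq_zero_of_lt_spatialNorm_sq hRpos), zero_mul]
    -- the pointwise divergence inequality
    have hdiv : ∀ x : E4, F (E4.spatial x) ≤ x 0 → x 0 ≤ s + F (E4.spatial x) →
        2 * M < Kerr.radius 0 x →
        Real.smoothTransition (Kerr.horizonFn M 0 x / ε - 1) *
            Real.smoothTransition (2 - E4.spatialNorm x ^ 2 / R ^ 2) * B x - (eh n x + eR n x) ≤
          ∑ μ, fderiv ℝ (fun y ↦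
            (Real.smoothTransition (Kerr.horizonFn M 0 y / (ε / (n + 1)) - 1) *
              Real.smoothTransition (2 - E4.spatialNorm y ^ 2 / R ^ 2)) * J y μ) x
            (E4.basisVector μ) := by
      intro x h1 h2 hx
      have hxpos : 0 < Kerr.radius 0 x := lt_trans (by positivity) hx
      have hu0 : 0 < Kerr.horizonFn M 0 x := by
        rw [Kerr.horizonFn, Kerr.rPlus_zero_right hM.le]
        exact mul_pos (sub_pos.2 hx) (Real.exp_pos _)
      have hWR0 : 0 ≤ Real.smoothTransition (2 - E4.spatialNorm x ^ 2 / R ^ 2) :=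
        Real.smoothTransition.nonneg _
      rw [heR]
      refine degILED_div_pointwise (eh := eh n)
        (ℓ := fun x ↦ Real.smoothTransition (Kerr.horizonFn M 0 x / ε - 1) *
          Real.smoothTransition (2 - E4.spatialNorm x ^ 2 / R ^ 2) * B x)
        (hWhd.contDiffAt.differentiableAt one_ne_zero)
        (hWRd.contDiffAt.differentiableAt one_ne_zero)
        (fun μ ↦ (hJ x hxpos μ).differentiableAt one_ne_zero)
        (Real.smoothTransition.nonneg _) hWR0 (hBJ x h1 hx) ?_ ?_
      · -- monotonicity of the horizon factor in `ε`
        exact mul_le_mul_of_nonneg_right (mul_le_mul_of_nonneg_right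
          (Real.smoothTransition.monotone (sub_le_sub_right
            (div_le_div_of_nonneg_left hu0.le hεn0 hεnε) 1)) hWR0) (hB0 x hx)
      · -- the horizon layer
        by_cases hxR : E4.spatialNorm x ≤ 2 * R
        · have hxT : x 0 ≤ s + |F 0| + 2 * R := by
            have h3 := hFub (E4.spatial x)
            have hsn : ‖E4.spatial x‖ = E4.spatialNorm x := rfl
            linarith
          have hεT' : 16 * (ε / (n + 1)) * Real.exp ((s + |F 0| + 2 * R) / (2 * M)) ≤ M :=
            le_trans (by gcongr) hεT
          have key := degILED_horizon_pointwise M _ _ Kh _ x (J x) hM hεn0 hKh (hDm0 x) hεT' hx hxT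
            (fun h3 ↦ hhor _ x hεn0 hx h3)
          have h4 := mul_le_mul_of_nonneg_left key hWR0
          rw [heh]
          linarith
        · have hWRz : Real.smoothTransition (2 - E4.spatialNorm x ^ 2 / R ^ 2) = 0 :=
            Real.smoothTransition.zero_of_nonpos (by
              rw [sub_nonpos, le_div_iff₀ (by positivity)]
              nlinarith [not_le.mp hxR, hRpos])
          rw [heh]
          simp [hWRz]
    -- the integrated inequality
    have key := weightedGraphFlux_integral_le_of_bulk (K := K)
      (W := fun x ↦ Real.smoothTransition (Kerr.horizonFn M 0 x / (ε / (n + 1)) - 1) *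
        Real.smoothTransition (2 - E4.spatialNorm x ^ 2 / R ^ 2)) (J := J)
      (ℓ := fun x ↦ Real.smoothTransition (Kerr.horizonFn M 0 x / ε - 1) *
        Real.smoothTransition (2 - E4.spatialNorm x ^ 2 / R ^ 2) * B x)
      (e := fun x ↦ eh n x + eR n x) (P := fun x ↦ 2 * M < Kerr.radius 0 x) (ρ := 2 * R)
      hKc (hWJ _ hεn0) hWK hF hρ (continuous_tailsCutWeight_mul R hM hε hBc) hℓK
      ((hehc n).add (heRc n)) (fun x ↦ add_nonneg (heh0 n x) (heR0 n x))
      (fun x hx ↦ by rw [(hez n x (hnotK x hx)).1, (hez n x (hnotK x hx)).2, add_zero]) hdiv hs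
    -- the leaf fluxes
    have hf0 := hflux (ε / (n + 1)) 0 hεn0 le_rfl
    have hfs := hflux (ε / (n + 1)) s hεn0 hs
    -- the error integral
    have hyI : ∀ u, Integrable (fun y : E3 ↦ eh n (E4.ofTimeSpace (u + F y) y)) ∧
        Integrable (fun y : E3 ↦ eR n (E4.ofTimeSpace (u + F y) y)) := by
      intro u
      have hg : Continuous fun y : E3 ↦ E4.ofTimeSpace (u + F y) y :=
        E4.continuous_ofTimeSpace' (continuous_const.add hF.continuous) continuous_id
      have hz : ∀ y : E3, y ∉ closedBall (0 : E3) (2 * R) →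
          eh n (E4.ofTimeSpace (u + F y) y) = 0 ∧ eR n (E4.ofTimeSpace (u + F y) y) = 0 := by
        intro y hy
        rw [mem_closedBall_zero_iff, not_le] at hy
        refine hez n _ (Or.inr ?_)
        rw [E4.spatialNorm_ofTimeSpace]
        nlinarith [hRpos, norm_nonneg y]
      exact ⟨((hehc n).comp hg).integrable_of_hasCompactSupport
          (HasCompactSupport.intro (isCompact_closedBall _ _) fun y hy ↦ (hz y hy).1),
        ((heRc n).comp hg).integrable_of_hasCompactSupport
          (HasCompactSupport.intro (isCompact_closedBall _ _) fun y hy ↦ (hz y hy).2)⟩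
    have herr : ∫ u in Ioc 0 s, ∫ y : E3,
        (eh n (E4.ofTimeSpace (u + F y) y) + eR n (E4.ofTimeSpace (u + F y) y)) ≤
        (∫ u in Ioc 0 s, ∫ y : E3, eh n (E4.ofTimeSpace (u + F y) y)) + s * (KR / R * Λr) := by
      have h1 : ∀ u ∈ Ioc 0 s, ∫ y : E3,
          (eh n (E4.ofTimeSpace (u + F y) y) + eR n (E4.ofTimeSpace (u + F y) y)) ≤
          (∫ y : E3, eh n (E4.ofTimeSpace (u + F y) y)) + KR / R * Λr := by
        intro u hu
        rw [integral_add (hyI u).1 (hyI u).2]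
        have h := hstat (ε / (n + 1)) u hεn0 hu.1.le
        exact add_le_add le_rfl (by rw [heR]; exact h)
      have h0 : ∀ u, 0 ≤ ∫ y : E3,
          (eh n (E4.ofTimeSpace (u + F y) y) + eR n (E4.ofTimeSpace (u + F y) y)) := fun u ↦
        integral_nonneg fun y ↦ add_nonneg (heh0 n _) (heR0 n _)
      calc _ ≤ ∫ u in Ioc 0 s, ((∫ y : E3, eh n (E4.ofTimeSpace (u + F y) y)) + KR / R * Λr) :=
            integral_mono_of_nonneg (Eventually.of_forall h0) ((hHI n).add (integrable_const _))
              ((ae_restrict_iff' measurableSet_Ioc).2 (Eventually.of_forall h1))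
        _ = _ := by
            rw [integral_add (hHI n) (integrable_const _), setIntegral_const, smul_eq_mul,
              Real.volume_real_Ioc_of_le hs, sub_zero]
    linarith [key, (abs_le.mp hf0).2, (abs_le.mp hfs).1, herr]
  -- ### Step 2: `n → ∞`
  have hlim : Tendsto (fun n : ℕ ↦ Kf * Λr + Kf * Λr +
      ((∫ u in Ioc 0 s, ∫ y : E3, eh n (E4.ofTimeSpace (u + F y) y)) + s * (KR / R * Λr)))
      atTop (𝓝 (Kf * Λr + Kf * Λr + (0 + s * (KR / R * Λr)))) :=
    (hT.add_const _).const_add _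
  have h := ge_of_tendsto' hlim hstep
  linarith

end Summit.FinalStateConjecture.FinalStateConjecture.Theorems
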